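import Literature.AnabelianGeometry.AbsoluteAnabelian.UnitKummerCyclotomeJunction
import HarnessLib

/-!
# [AbsTopIII] Prop 3.3 (i) clause (c) / Rmk 3.2.1: the junction `Λ(k̄ˣ) ≃* μ_Ẑ(G_k)` is GALOIS-EQUIVARIANT

S. Mochizuki, *Topics in absolute anabelian geometry III*, §3, Rmk. 3.2.1 and Prop. 3.3 (i) p. 73 (bib key
`MochizukiAbsTopIII2015`): «the natural isomorphism `μ_Ẑ(M) ⥲ μ_Ẑ(G)`» — compatible with the Galois actions ([AbsAnab]
Prop. 1.2.1 (vi) «Galois-equivariant», Cor. 1.10 (a)).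

abc-iut cell, layer L4, row «P33i-CYC-JUNCTION-EQUIVARIANCE» (self-named in the seat's fit per abc-iut-L4-lead RULING #6v;
seat abc-iut-w4-d009 gen 4).  PROOF-ONLY, 0 defs.  `UnitKummerCyclotomeJunction.lean` (p432997) identifies the cyclotome
target `Λ(k̄ˣ) = Ẑ(1)` of the presented unit Kummer theories with abc-iut-L4-t1's group-theoretic `μ_Ẑ(G_k)`,
`G_k = Gal(k^alg/k)`, through `MLFClosure.cyclotomeUnitsEquivMuZhat` — `Λ` of the units of `ε : k̄ ≃ₐ[k] k^alg`
(`IsAlgClosure.equiv`) followed by the inverse of abc-iut-L4-t17's `muZhatEquiv` of CHOSEN reciprocity data — honestly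
labelled «chosen, not canonical».  What the word «natural» requires beyond the `{±1}`/`Ẑ^×` ambiguity print itself allows
is compatibility with the group actions, and that holds for EVERY choice:

* `MLFClosure.cyclotomeUnitsEquivMuZhat_symm_apply_coe` — components of the inverse junction;
* **`MLFClosure.cyclotomeUnitsEquivMuZhat_symm_smul_coe`** — for `σ ∈ G_k` acting on `μ_Ẑ(G_k)` by conjugation
  (abc-iut-L4-t1's `muQZ.instDistribMulAction`) and on `k̄` through `ε⁻¹ σ ε = AlgEquiv.autCongr ε.symm σ ∈ Gal(k̄/k)`:
  `junction⁻¹ (σ • η) = (ε⁻¹ σ ε) (junction⁻¹ η)` componentwise — from abc-iut-L4-t17's `muZhatEquiv_smul_coe`;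
* **`ModelMLFGaloisData.cyclotomeUnitsEquivMuZhat_smul`** (`'`) — for model data `D = (Π_k ↠ G_k ↷ k̄)` and `g ∈ Π_k`:
  `junction (g • ζ) = (ε (ε_k g) ε⁻¹) • junction ζ`, i.e. the `Π_k ↷ Λ(k̄ˣ)` action carried by the unit Kummer theories
  corresponds to the conjugation action of `G_k` on `μ_Ẑ(G_k)` through `Π_k ↠ Gal(k̄/k) ≅ Gal(k^alg/k)`.

HONEST FRAMING: classical; nothing here bears on [IUTchIII] Cor. 3.12; no side taken.
-/

noncomputable section

namespace Literature.AnabelianGeometry.AbsoluteAnabelian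

universe u

namespace MLFClosure

variable (C : MLFClosure.{u})

/-- Components of the inverse junction `μ_Ẑ(G_k) → Λ(k̄ˣ)`: `ε⁻¹` of the components of abc-iut-L4-t17's `muZhatEquiv`.
[cite: MochizukiAbsTopIII2015, Remark 3.2.1 p.73] -/
theorem cyclotomeUnitsEquivMuZhat_symm_apply_coe (η : muZhat (Field.absoluteGaloisGroup C.k)) (n : ℕ+) :
    (((C.cyclotomeUnitsEquivMuZhat.symm η : EtaleTheta.cyclotome (C.K)ˣ) : ℕ+ → (C.K)ˣ) n : C.K) =
      (IsAlgClosure.equiv C.k C.K (AlgebraicClosure C.k)).symm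
        (((C.reciprocityData.muZhatEquiv η : EtaleTheta.cyclotome (AlgebraicClosure C.k)ˣ) :
          ℕ+ → (AlgebraicClosure C.k)ˣ) n : AlgebraicClosure C.k) :=
  rfl

/-- **Galois-equivariance of the junction** (inverse form, componentwise): for `σ ∈ G_k = Gal(k^alg/k)`, acting on `μ_Ẑ(G_k)`
by conjugation and on `k̄` through `ε⁻¹ σ ε ∈ Gal(k̄/k)` (`ε : k̄ ≃ₐ[k] k^alg` the chosen comparison of closures),
`junction⁻¹ (σ • η)` has components `(ε⁻¹ σ ε)` of those of `junction⁻¹ η`. [cite: MochizukiAbsTopIII2015, Remark 3.2.1 p.73] -/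
theorem cyclotomeUnitsEquivMuZhat_symm_smul_coe (σ : Field.absoluteGaloisGroup C.k)
    (η : muZhat (Field.absoluteGaloisGroup C.k)) (n : ℕ+) :
    (((C.cyclotomeUnitsEquivMuZhat.symm (σ • η) : EtaleTheta.cyclotome (C.K)ˣ) : ℕ+ → (C.K)ˣ) n : C.K) =
      AlgEquiv.autCongr (IsAlgClosure.equiv C.k C.K (AlgebraicClosure C.k)).symm σ
        ((((C.cyclotomeUnitsEquivMuZhat.symm η : EtaleTheta.cyclotome (C.K)ˣ) : ℕ+ → (C.K)ˣ) n : C.K)) := by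
  rw [cyclotomeUnitsEquivMuZhat_symm_apply_coe, cyclotomeUnitsEquivMuZhat_symm_apply_coe,
    C.reciprocityData.muZhatEquiv_smul_coe σ η n, AlgEquiv.autCongr_apply, AlgEquiv.trans_apply, AlgEquiv.trans_apply,
    AlgEquiv.symm_symm, AlgEquiv.apply_symm_apply]
  rfl

end MLFClosure

namespace ModelMLFGaloisData

variable {C : MLFClosure.{u}} (D : ModelMLFGaloisData C.k C.K)

/-- **Galois-equivariance of the junction at the model data**: for `g ∈ Π_k` (acting on `k̄ˣ` through `ε_k : Π_k ↠ Gal(k̄/k)`)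
and `ζ ∈ Λ(k̄ˣ)`, `junction (g • ζ) = (ε (ε_k g) ε⁻¹) • junction ζ` — the `Π_k`-action on the cyclotome of the unit Kummer
theories matches abc-iut-L4-t1's conjugation action of `G_k` on the group-theoretic `μ_Ẑ(G_k)` through
`Π_k ↠ Gal(k̄/k) ≅ Gal(k^alg/k)`. [cite: MochizukiAbsTopIII2015, Proposition 3.3 (i) p.73] -/
theorem cyclotomeUnitsEquivMuZhat_smul (g : D.Pi) (ζ : EtaleTheta.cyclotome (C.K)ˣ) (σ : Field.absoluteGaloisGroup C.k)
    (hσ : σ = AlgEquiv.autCongr (IsAlgClosure.equiv C.k C.K (AlgebraicClosure C.k)) (D.aug g)) :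
    C.cyclotomeUnitsEquivMuZhat (g • ζ) = σ • C.cyclotomeUnitsEquivMuZhat ζ := by
  subst hσ
  apply C.cyclotomeUnitsEquivMuZhat.symm.injective
  rw [MulEquiv.symm_apply_apply]
  refine Subtype.ext (funext fun n => Units.ext ?_)
  rw [C.cyclotomeUnitsEquivMuZhat_symm_smul_coe, ← AlgEquiv.autCongr_symm, MulEquiv.symm_apply_apply,
    MulEquiv.symm_apply_apply, EtaleTheta.cyclotome.smul_apply, units_coe_smul]
  rfl

/-- The same with the Galois element written out: `junction (g • ζ) = (ε ∘ ε_k(g) ∘ ε⁻¹) • junction ζ`.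
[cite: MochizukiAbsTopIII2015, Proposition 3.3 (i) p.73] -/
theorem cyclotomeUnitsEquivMuZhat_smul' (g : D.Pi) (ζ : EtaleTheta.cyclotome (C.K)ˣ) :
    C.cyclotomeUnitsEquivMuZhat (g • ζ) =
      (show Field.absoluteGaloisGroup C.k from
          AlgEquiv.autCongr (IsAlgClosure.equiv C.k C.K (AlgebraicClosure C.k)) (D.aug g)) •
        C.cyclotomeUnitsEquivMuZhat ζ :=
  D.cyclotomeUnitsEquivMuZhat_smul g ζ _ rfl

end ModelMLFGaloisData

end Literature.AnabelianGeometry.AbsoluteAnabelian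

end
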